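import Literature.NumberTheory.LFunctions.CertifiedLFunctionWindowAliasingBound
import Literature.Analysis.Complex.CahenMellinSector
import HarnessLib

/-!
# Platt's Algorithm 2: the Fourier transforms `F̂_e`, `F̂_o` as theta series
# (Math. Comp. 85 (2016) §7.1, Lemmas 7.1–7.2)

Topic `Literature/NumberTheory/LFunctions`; namespace `Literature.NumberTheory.LFunctions`, engine
sub-namespace `FourierTheta`. Everything in this file is PROVED (no named fact, no new definition).
Typed for the parity-realchar cell (D-0088 (4) literature-typing layer, row «Platt 2016 (Math. Comp.,
certified GRH/`L`-function computations)»): instrument provenance for the second of the two algorithms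
behind Platt's GRH verification `Literature.NumberTheory.LFunctions.platt2016_theorem71/72`
(`DirichletLRiemannHypothesisUpTo.lean`) — "Algorithm 2" (journal §7; arXiv:1305.3087v1 §5), Booker's
rigorous FFT method specialised to Dirichlet `L`-functions, which served the moduli `q < 10000`
(§9.2). Its input (step (1) of the outline on p. 3017) is the Fourier transform of

  `F_e(t, χ) := ε_χ q^{it/2} π^{-(1/2+it)/2} Γ((1/2+it)/2) exp(πηt/4) L_χ(1/2+it)`  (`χ` even),
  `F_o(t, χ) := ε_χ q^{it/2} π^{-(3/2+it)/2} Γ((3/2+it)/2) exp(πηt/4) L_χ(1/2+it)`  (`χ` odd),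

`η ∈ (-1, 1)`, namely `F̂(x, χ) := (1/(2π)) ∫ F(t, χ) e^{-ixt} dt` (p. 3017), and Lemmas 7.1–7.2 compute it
in closed form as a rapidly convergent theta series (the DFT pair and the up-sampling certificates of
the later steps are `CertifiedLFunctionDFTPair.lean`, `CertifiedLFunctionUpsampling.lean`,
`CertifiedLFunctionWindowAliasingBound.lean`).

Source: D. J. Platt, *Numerical computations concerning the GRH*, Math. Comp. **85** (2016) 3009–3027
[Platt2016GRH], §7.1 p. 3018 (journal pdf, AMS open access; page-checked), with `F_e`, `F_o`, `F̂` defined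
on p. 3017. Numbering: journal Lemmas 7.1/7.2 = arXiv:1305.3087v1 Lemmas 5.1/5.2.

## Contents (all proved)

* `platt2016_lemma71_72` — both lemmas at once, over the parity `a = charParity χ ∈ {0, 1}`
  (`F(t) = ε q^{it/2} π^{-(1/2+a+it)/2} Γ((1/2+a+it)/2) e^{πηt/4} L_χ(1/2+it)`): for `χ` primitive mod
  `q > 1`, `|η| < 1`, `x ∈ ℝ`, `u = πηi/4 + x`,
  `(1/(2π)) ∫ F(t) e^{-ixt} dt = 2 ε e^{(1/2+a)u} q^{-(1/2+a)/2} Σ_{n ≥ 1} n^a χ(n) exp(-π n² e^{2u}/q)`.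
* `platt2016_lemma71` — **Lemma 7.1 as printed** (`χ` even):
  `F̂_e(x, χ) = (2 ε_χ exp(u(x)/2) / q^{1/4}) Σ_{n=1}^∞ χ(n) exp(-π n² exp(2u(x))/q)`.
* `platt2016_lemma72` — **Lemma 7.2 as printed** (`χ` odd):
  `F̂_o(x, χ) = (2 ε_χ exp(3u(x)/2) / q^{3/4}) Σ_{n=1}^∞ n χ(n) exp(-π n² exp(2u(x))/q)`.
  (In both, the sum is written over `n : ℕ`; the `n = 0` term vanishes as `χ(0) = 0` for `q > 1`. The
  identities hold for every `ε ∈ ℂ`; Platt takes `|ε_χ| = 1`.)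
* Engine (`FourierTheta.*`, the steps of the printed proof of Lemma 7.1, p. 3018): with
  `Φ_x(s) := ε q^{(s-1/2)/2} π^{-(s+a)/2} Γ((s+a)/2) exp(-u(x)(s-1/2)) L_χ(s)` —
  "Writing `s = 1/2 + it`": `F(t) e^{-ixt} = Φ_x(1/2+it)` (`fourier_integrand_eq`; the printed
  `exp(-(πηi + 4x)(s-1/2)/4) = exp(-u(x)(s-1/2))`); the shift from `Re s = 1/2` to `Re s = 2`:
  holomorphy (`differentiableAt_integrand`), the strip majorant
  `|Φ_x(σ+iT)| ≪ (1+|T|)² e^{-π(1-|η|)|T|/4}` (`norm_integrand_le`, from uniform Stirling — the tree's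
  `GammaStirling.exists_norm_Gamma_vertical_le` — and the linear bound for `L_χ` of
  `WindowAliasing.norm_LFunction_le_linear`), integrability on the lines and decay at the ends
  (`integrable_integrand_vertical`, `decay_integrand`); on `Re s = 2`:
  `q^{(s-1/2)/2} π^{-(s+a)/2} e^{-u(s-1/2)} χ(n) n^{-s} = n^a χ(n) e^{(1/2+a)u} q^{-(1/2+a)/2} (πn²e^{2u}/q)^{-(s+a)/2}`
  (`farLine_term_eq`, the printed third and fourth equalities), the termwise Mellin–Barnes/Cahen integral
  `(1/2πi) ∫_{(2)} Γ((s+a)/2) z^{-(s+a)/2} ds = 2 e^{-z}` for `Re z > 0` (`integral_farLine_term`, via the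
  tree's `Literature.Analysis.Complex.integral_Gamma_mul_cpow_neg_eq`), and the interchange of sum and
  integral (`integrable_farLine_term`, `summable_integral_norm_farLine_term`).

## Method (the printed proof, p. 3018)

"Writing `s = 1/2 + it` we get
`F̂_e(x, χ) = (ε/2πi) ∫_{Re s = 1/2} q^{(s-1/2)/2} π^{-s/2} Γ(s/2) exp(-(πηi + 4x)(s-1/2)/4) L_χ(s) ds`
`= (ε/2πi) ∫_{Re s = 2} q^{(s-1/2)/2} π^{-s/2} Γ(s/2) exp(-u(x)(s-1/2)) L_χ(s) ds`
`= (ε e^{u(x)/2}/q^{1/4}) (1/2πi) ∫_{Re s = 2} (q/π)^{s/2} Γ(s/2) exp(2u(x))^{-s/2} Σ_{n≥1} χ(n) n^{-s} ds`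
`= (ε e^{u(x)/2}/q^{1/4}) Σ_{n≥1} χ(n) (1/2πi) ∫_{Re s = 2} (πn²/q)^{-s/2} Γ(s/2) exp(2u(x))^{-s/2} ds`
`= (2ε e^{u(x)/2}/q^{1/4}) Σ_{n≥1} χ(n) exp(-πn² exp(2u(x))/q)`,
as required"; for Lemma 7.2 "the proof follows the same lines" (with `Γ((s+1)/2)`, `π^{-(s+1)/2}`).
The shift of the line of integration (rectangles `|Im s| ≤ T`, `T → ∞`) is the tree's
`Literature.Analysis.Complex.integral_vertical_eq_of_differentiableOn`; it is legitimate because `L_χ` is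
entire (`χ` primitive, `q > 1`) and, on `1/2 ≤ Re s ≤ 2`,
`|Γ((s+a)/2)| ≪ (1+|T|) e^{-π|T|/4}` while `|exp(-u(s-1/2))| = e^{-x(σ-1/2)} e^{πηT/4}` and `|L_χ(s)| ≪ 1+|T|`,
so the integrand is `≪ (1+|T|)² e^{-π(1-|η|)|T|/4}` — this is where `|η| < 1` enters. The last step is the
Cahen–Mellin integral in the sector `|arg z| < π/2` (`z = πn²e^{2u}/q`, `arg z = πη/2`), with the principal
branch: `log z = log(πn²/q) + 2u` since `|Im 2u| = π|η|/2 < π`.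

NOT here: the truncation bound for the theta series ("by reference to Lemma 5.4 of [3] or by majorising
the missing terms with the obvious geometric series", p. 3018), Lemmas 7.4–7.6 (which cite Booker's
Lemmas 5.4–5.7, not in the tree), and the parameter choices of §9.

`lean search` (2026-08-27): the tree has the Cahen–Mellin integral for complex `z` with `Re z > 0`
(`CahenMellinSector.lean`), the heat-kernel representation of a Dirichlet series for REAL `w`
(`CahenMellinDirichlet.tsum_mul_exp_neg_eq_integral_LSeries`, not usable here: `u` is complex and the
line is `Re s = 1/2`), uniform Stirling on vertical lines (`GammaStirlingVertical.lean`), the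
vertical-line shift lemma, and Mathlib's `DirichletCharacter.LFunction_eq_LSeries`; nothing is restated.

## References

* [Platt2016GRH] D. J. Platt, *Numerical computations concerning the GRH*, Math. Comp. 85 (2016),
  no. 302, 3009–3027, doi:10.1090/mcom/3077: §7 "Algorithm 2", `F_e`, `F_o`, `F̂` p. 3017, Lemmas 7.1–7.2
  p. 3018 (arXiv:1305.3087v1 §5, Lemmas 5.1–5.2).
* A. R. Booker, *Artin's conjecture, Turing's method, and the Riemann hypothesis*, Experiment. Math. 15
  (2006) 385–407 (Platt's [3]; the method being specialised). [Booker2006]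
* E. C. Titchmarsh, *The Theory of the Riemann Zeta-Function*, §2.15 (the Cahen–Mellin integral).
  [folklore]
-/

noncomputable section

open Complex Filter Topology Set MeasureTheory DirichletCharacter
open scoped Real Nat

namespace Literature.NumberTheory.LFunctions

namespace FourierTheta

/-! ## §1 Polynomial-times-exponential majorants -/

/-- `e^{-c|u|}` is integrable on `ℝ` (`c > 0`). [folklore] -/
private theorem integrable_exp_neg_mul_abs {c : ℝ} (hc : 0 < c) :
    Integrable fun u : ℝ => Real.exp (-(c * |u|)) := by
  have hIoi : IntegrableOn (fun u : ℝ => Real.exp (-(c * |u|))) (Ioi 0) :=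
    (exp_neg_integrableOn_Ioi 0 hc).congr_fun (fun u hu => by
      simp only [abs_of_pos (show (0 : ℝ) < u from hu), neg_mul]) measurableSet_Ioi
  have hIic : IntegrableOn (fun u : ℝ => Real.exp (-(c * |u|))) (Iic 0) := by
    rw [← Measure.map_neg_eq_self (volume : Measure ℝ)]
    let m : MeasurableEmbedding fun x : ℝ => -x := (Homeomorph.neg ℝ).measurableEmbedding
    rw [m.integrableOn_map_iff]
    simp_rw [Function.comp_def, abs_neg, neg_preimage, neg_Iic, neg_zero]
    exact Iff.mpr integrableOn_Ici_iff_integrableOn_Ioi hIoi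
  have := hIic.union hIoi
  rwa [Iic_union_Ioi, integrableOn_univ] at this

/-- `(1+|u|)^k e^{-δ|u|} ≤ k! (2/δ)^k e^{δ/2} e^{-δ|u|/2}` (from `y^k/k! ≤ e^y`). [folklore] -/
private theorem one_add_abs_pow_mul_exp_le (k : ℕ) {δ : ℝ} (hδ : 0 < δ) (u : ℝ) :
    (1 + |u|) ^ k * Real.exp (-(δ * |u|)) ≤
      k ! * (2 / δ) ^ k * Real.exp (δ / 2) * Real.exp (-(δ / 2 * |u|)) := by
  have hu : 0 ≤ |u| := abs_nonneg u
  have h1 := Real.pow_div_factorial_le_exp (δ / 2 * (1 + |u|)) (by positivity) k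
  rw [div_le_iff₀ (by positivity)] at h1
  -- `(1+|u|)^k ≤ k! (2/δ)^k e^{δ/2 (1+|u|)}`
  have h2 : (1 + |u|) ^ k ≤ k ! * (2 / δ) ^ k * Real.exp (δ / 2 * (1 + |u|)) := by
    have hpow : (δ / 2 * (1 + |u|)) ^ k = (δ / 2) ^ k * (1 + |u|) ^ k := mul_pow _ _ _
    rw [hpow] at h1
    have hδk : 0 < (δ / 2) ^ k := by positivity
    calc (1 + |u|) ^ k = (2 / δ) ^ k * ((δ / 2) ^ k * (1 + |u|) ^ k) := by
          rw [← mul_assoc, ← mul_pow]; field_simp; simp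
      _ ≤ (2 / δ) ^ k * (Real.exp (δ / 2 * (1 + |u|)) * k !) := by gcongr
      _ = k ! * (2 / δ) ^ k * Real.exp (δ / 2 * (1 + |u|)) := by ring
  have h3 : Real.exp (δ / 2 * (1 + |u|)) * Real.exp (-(δ * |u|)) =
      Real.exp (δ / 2) * Real.exp (-(δ / 2 * |u|)) := by
    rw [← Real.exp_add, ← Real.exp_add]; congr 1; ring
  calc (1 + |u|) ^ k * Real.exp (-(δ * |u|))
      ≤ k ! * (2 / δ) ^ k * Real.exp (δ / 2 * (1 + |u|)) * Real.exp (-(δ * |u|)) := by gcongr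
    _ = k ! * (2 / δ) ^ k * Real.exp (δ / 2) * Real.exp (-(δ / 2 * |u|)) := by
        rw [mul_assoc, h3, ← mul_assoc]

/-- `(1+|u|)^k e^{-δ|u|}` is integrable on `ℝ` (`δ > 0`). [folklore] -/
private theorem integrable_one_add_abs_pow_mul_exp (k : ℕ) {δ : ℝ} (hδ : 0 < δ) :
    Integrable fun u : ℝ => (1 + |u|) ^ k * Real.exp (-(δ * |u|)) := by
  have hg := (integrable_exp_neg_mul_abs (half_pos hδ)).const_mul (k ! * (2 / δ) ^ k * Real.exp (δ / 2))
  refine hg.mono' (by fun_prop) (ae_of_all _ fun u => ?_)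
  rw [Real.norm_of_nonneg (by positivity)]
  exact one_add_abs_pow_mul_exp_le k hδ u

/-- `K (1+|T|)^k e^{-δ|T|} ≤ ε` for `|T|` large. [folklore] -/
private theorem eventually_one_add_abs_pow_mul_exp_le (K : ℝ) (k : ℕ) {δ : ℝ} (hδ : 0 < δ) {ε : ℝ}
    (hε : 0 < ε) :
    ∃ T₀ : ℝ, ∀ T : ℝ, T₀ ≤ |T| → K * ((1 + |T|) ^ k * Real.exp (-(δ * |T|))) ≤ ε := by
  set K' : ℝ := |K| * (k ! * (2 / δ) ^ k * Real.exp (δ / 2)) with hK'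
  have hK'0 : 0 ≤ K' := by positivity
  -- `K' e^{-(δ/2) R} → 0`
  have ht : Tendsto (fun R : ℝ => K' * Real.exp (-(δ / 2 * R))) atTop (𝓝 0) := by
    have h1 : Tendsto (fun R : ℝ => Real.exp (-(δ / 2 * R))) atTop (𝓝 0) := by
      have := Real.tendsto_exp_neg_atTop_nhds_zero.comp
        (tendsto_id.const_mul_atTop (half_pos hδ))
      refine this.congr fun R => ?_
      simp
    simpa using h1.const_mul K'
  rw [Metric.tendsto_nhds] at ht
  obtain ⟨R₀, hR₀⟩ := Filter.eventually_atTop.mp (ht ε hε)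
  refine ⟨R₀, fun T hT => ?_⟩
  have h := hR₀ |T| hT
  rw [Real.dist_eq, sub_zero, abs_of_nonneg (by positivity)] at h
  calc K * ((1 + |T|) ^ k * Real.exp (-(δ * |T|)))
      ≤ |K| * ((1 + |T|) ^ k * Real.exp (-(δ * |T|))) :=
        mul_le_mul_of_nonneg_right (le_abs_self K) (by positivity)
    _ ≤ |K| * (k ! * (2 / δ) ^ k * Real.exp (δ / 2) * Real.exp (-(δ / 2 * |T|))) :=
        mul_le_mul_of_nonneg_left (one_add_abs_pow_mul_exp_le k hδ T) (abs_nonneg K)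
    _ = K' * Real.exp (-(δ / 2 * |T|)) := by rw [hK']; ring
    _ ≤ ε := h.le

/-! ## §2 The factors of `Φ_x(s)` on the strip `1/2 ≤ Re s ≤ 2` -/

/-- Uniform Stirling on the strip `1/4 ≤ Re w ≤ 3/2`: `‖Γ(w)‖ ≤ G (1 + 2|Im w|) e^{-π|Im w|/2}` (the tree's
`GammaStirling.exists_norm_Gamma_vertical_le` for `|Im w| ≥ 1`, `|Γ(w)| ≤ Γ(Re w)` and convexity of `Γ`
below). [folklore] -/
private theorem exists_norm_Gamma_strip_le :
    ∃ G : ℝ, 0 < G ∧ ∀ w : ℂ, 1 / 4 ≤ w.re → w.re ≤ 3 / 2 →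
      ‖Complex.Gamma w‖ ≤ G * ((1 + 2 * |w.im|) * Real.exp (-(π / 2 * |w.im|))) := by
  obtain ⟨C, hC, hst⟩ :=
    Literature.Analysis.SpecialFunctions.GammaStirling.exists_norm_Gamma_vertical_le (1 / 4) (3 / 2)
  set G₀ : ℝ := max (Real.Gamma (1 / 4)) (Real.Gamma (3 / 2)) with hG₀
  have hG₀pos : 0 < G₀ := lt_max_of_lt_right (Real.Gamma_pos_of_pos (by norm_num))
  refine ⟨C + G₀ * Real.exp (π / 2), by positivity, fun w h1 h2 => ?_⟩
  have hw : w = (w.re : ℂ) + w.im * I := (Complex.re_add_im w).symm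
  have him : 0 ≤ |w.im| := abs_nonneg _
  rcases le_or_gt 1 |w.im| with hbig | hsmall
  · -- Stirling
    have h := hst w.re ⟨h1, h2⟩ w.im hbig
    rw [← hw] at h
    have hp : |w.im| ^ (w.re - 1 / 2) ≤ 1 + 2 * |w.im| := by
      calc |w.im| ^ (w.re - 1 / 2) ≤ |w.im| ^ (1 : ℝ) :=
            Real.rpow_le_rpow_of_exponent_le hbig (by linarith)
        _ = |w.im| := Real.rpow_one _
        _ ≤ 1 + 2 * |w.im| := by linarith
    have he : Real.exp (-(π * |w.im|) / 2) = Real.exp (-(π / 2 * |w.im|)) := by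
      congr 1; ring
    calc ‖Complex.Gamma w‖ ≤ C * |w.im| ^ (w.re - 1 / 2) * Real.exp (-(π * |w.im|) / 2) := h
      _ ≤ C * (1 + 2 * |w.im|) * Real.exp (-(π * |w.im|) / 2) := by gcongr
      _ = C * ((1 + 2 * |w.im|) * Real.exp (-(π / 2 * |w.im|))) := by rw [he]; ring
      _ ≤ (C + G₀ * Real.exp (π / 2)) * ((1 + 2 * |w.im|) * Real.exp (-(π / 2 * |w.im|))) := by
          gcongr; linarith [mul_pos hG₀pos (Real.exp_pos (π / 2))]
  · -- `|Im w| < 1`: `‖Γ(w)‖ ≤ Γ(Re w) ≤ G₀`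
    have hre : 0 < w.re := by linarith
    have h := Literature.Analysis.SpecialFunctions.GammaVert.norm_Gamma_le_Gamma_re hre w.im
    rw [← hw] at h
    have hG : Real.Gamma w.re ≤ G₀ := by
      have hseg : w.re ∈ segment ℝ (1 / 4 : ℝ) (3 / 2) := by
        rw [segment_eq_Icc (by norm_num)]; exact ⟨h1, h2⟩
      exact Real.convexOn_Gamma.le_on_segment (by norm_num) (by norm_num) hseg
    have hexp : 1 ≤ Real.exp (π / 2) * Real.exp (-(π / 2 * |w.im|)) := by
      rw [← Real.exp_add]
      exact Real.one_le_exp (by nlinarith [Real.pi_pos])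
    calc ‖Complex.Gamma w‖ ≤ Real.Gamma w.re := h
      _ ≤ G₀ := hG
      _ ≤ G₀ * (Real.exp (π / 2) * Real.exp (-(π / 2 * |w.im|))) * (1 + 2 * |w.im|) := by
          have : G₀ ≤ G₀ * (Real.exp (π / 2) * Real.exp (-(π / 2 * |w.im|))) :=
            le_mul_of_one_le_right hG₀pos.le hexp
          exact this.trans (le_mul_of_one_le_right (by positivity) (by linarith))
      _ = G₀ * Real.exp (π / 2) * ((1 + 2 * |w.im|) * Real.exp (-(π / 2 * |w.im|))) := by ring
      _ ≤ (C + G₀ * Real.exp (π / 2)) * ((1 + 2 * |w.im|) * Real.exp (-(π / 2 * |w.im|))) := by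
          gcongr; linarith

/-- `‖r^w‖ = r^{Re w}` for real `r > 0`. [folklore] -/
private theorem norm_ofReal_cpow {r : ℝ} (hr : 0 < r) (w : ℂ) : ‖(r : ℂ) ^ w‖ = r ^ w.re :=
  Complex.norm_cpow_eq_rpow_re_of_pos hr w

/-- `‖exp(-u(x)(s - 1/2))‖ = e^{-x(Re s - 1/2) + πη Im s/4}`, `u(x) = πηi/4 + x`. [folklore] -/
private theorem norm_exp_u (η x : ℝ) (s : ℂ) :
    ‖Complex.exp (-(π * η * I / 4 + x) * (s - 1 / 2))‖ =
      Real.exp (-(x * (s.re - 1 / 2)) + π * η * s.im / 4) := by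
  rw [Complex.norm_exp]
  congr 1
  have e : (-(π * η * I / 4 + x) * (s - 1 / 2) : ℂ) =
      -(((π * η / 4 : ℝ) : ℂ) * I + (x : ℂ)) * (((s.re - 1 / 2 : ℝ) : ℂ) + (s.im : ℂ) * I) := by
    conv_lhs => rw [← Complex.re_add_im s]
    push_cast; ring
  rw [e]
  simp only [neg_mul, Complex.neg_re, Complex.mul_re, Complex.add_re, Complex.add_im,
    Complex.mul_im, Complex.ofReal_re, Complex.ofReal_im, Complex.I_re, Complex.I_im]
  ring

/-- The `L`-free part of `Φ_x` on `1/2 ≤ Re s ≤ 2`: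
`‖ε q^{(s-1/2)/2} π^{-(s+a)/2} Γ((s+a)/2) e^{-u(s-1/2)}‖ ≤ ‖ε‖ q^{3/4} G e^{3|x|/2} (1+|Im s|) e^{-π(1-|η|)|Im s|/4}`.
[folklore] -/
private theorem norm_A_le {q : ℕ} (hq : 1 < q) (a : ℕ) (ha1 : a ≤ 1) (ε : ℂ) (η x : ℝ)
    {G : ℝ} (hG0 : 0 < G)
    (hG : ∀ w : ℂ, 1 / 4 ≤ w.re → w.re ≤ 3 / 2 →
      ‖Complex.Gamma w‖ ≤ G * ((1 + 2 * |w.im|) * Real.exp (-(π / 2 * |w.im|))))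
    {s : ℂ} (h1 : 1 / 2 ≤ s.re) (h2 : s.re ≤ 2) :
    ‖ε * (q : ℂ) ^ ((s - 1 / 2) / 2) * (π : ℂ) ^ (-(s + a) / 2) *
        Complex.Gamma ((s + a) / 2) * Complex.exp (-(π * η * I / 4 + x) * (s - 1 / 2))‖ ≤
      ‖ε‖ * (q : ℝ) ^ ((3 : ℝ) / 4) * G * Real.exp (3 / 2 * |x|) *
        ((1 + |s.im|) * Real.exp (-(π * (1 - |η|) / 4 * |s.im|))) := by
  have ha1R : (a : ℝ) ≤ 1 := by exact_mod_cast ha1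
  have ha0R : (0 : ℝ) ≤ a := Nat.cast_nonneg a
  have hqpos : 0 < q := by omega
  have hqR : (1 : ℝ) ≤ q := by exact_mod_cast hqpos
  have hqR0 : (0 : ℝ) < q := by positivity
  have hT : 0 ≤ |s.im| := abs_nonneg _
  have f2 : ‖(q : ℂ) ^ ((s - 1 / 2) / 2)‖ ≤ (q : ℝ) ^ ((3 : ℝ) / 4) := by
    rw [show (q : ℂ) = ((q : ℝ) : ℂ) by simp, norm_ofReal_cpow hqR0]
    refine Real.rpow_le_rpow_of_exponent_le hqR ?_
    simp; linarith
  have f3 : ‖(π : ℂ) ^ (-(s + a) / 2)‖ ≤ 1 := by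
    rw [norm_ofReal_cpow Real.pi_pos]
    refine Real.rpow_le_one_of_one_le_of_nonpos (by linarith [Real.pi_gt_three]) ?_
    simp; linarith
  have f4 : ‖Complex.Gamma ((s + a) / 2)‖ ≤
      G * ((1 + |s.im|) * Real.exp (-(π / 4 * |s.im|))) := by
    have hre : ((s + a) / 2 : ℂ).re = (s.re + a) / 2 := by simp
    have him : ((s + a) / 2 : ℂ).im = s.im / 2 := by simp
    have h := hG ((s + a) / 2) (by rw [hre]; linarith) (by rw [hre]; linarith)
    rw [him, abs_div, abs_two] at h
    convert h using 3 <;> ring_nf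
  have f5 : ‖Complex.exp (-(π * η * I / 4 + x) * (s - 1 / 2))‖ ≤
      Real.exp (3 / 2 * |x|) * Real.exp (π * |η| / 4 * |s.im|) := by
    rw [norm_exp_u, ← Real.exp_add, Real.exp_le_exp]
    have hb1 : -(x * (s.re - 1 / 2)) ≤ 3 / 2 * |x| := by
      have : |x * (s.re - 1 / 2)| ≤ |x| * (3 / 2) := by
        rw [abs_mul]; gcongr; rw [abs_le]; constructor <;> linarith
      linarith [neg_abs_le (x * (s.re - 1 / 2))]
    have hb2 : π * η * s.im / 4 ≤ π * |η| / 4 * |s.im| := by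
      have : η * s.im ≤ |η| * |s.im| := by rw [← abs_mul]; exact le_abs_self _
      nlinarith [Real.pi_pos]
    linarith
  rw [norm_mul, norm_mul, norm_mul, norm_mul]
  calc ‖ε‖ * ‖(q : ℂ) ^ ((s - 1 / 2) / 2)‖ * ‖(π : ℂ) ^ (-(s + a) / 2)‖ *
        ‖Complex.Gamma ((s + a) / 2)‖ * ‖Complex.exp (-(π * η * I / 4 + x) * (s - 1 / 2))‖
      ≤ ‖ε‖ * (q : ℝ) ^ ((3 : ℝ) / 4) * 1 * (G * ((1 + |s.im|) * Real.exp (-(π / 4 * |s.im|)))) *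
        (Real.exp (3 / 2 * |x|) * Real.exp (π * |η| / 4 * |s.im|)) := by
        gcongr
    _ = ‖ε‖ * (q : ℝ) ^ ((3 : ℝ) / 4) * G * Real.exp (3 / 2 * |x|) *
        ((1 + |s.im|) * (Real.exp (-(π / 4 * |s.im|)) * Real.exp (π * |η| / 4 * |s.im|))) := by
        ring
    _ = _ := by
        rw [← Real.exp_add]; congr 3; ring

/-! ## §3 Platt's integrand `Φ_x`: majorant, holomorphy, integrability, decay -/

/-- **The integrand on the strip.** For `1/2 ≤ Re s ≤ 2`, Platt's integrand
`Φ_x(s) = ε q^{(s-1/2)/2} π^{-(s+a_χ)/2} Γ((s+a_χ)/2) exp(-u(x)(s-1/2)) L_χ(s)` (p. 3018, `u(x) = πηi/4 + x`)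
satisfies `‖Φ_x(σ+iT)‖ ≤ K · (1+|T|)² e^{-π(1-|η|)|T|/4}` with
`K = ‖ε‖ q^{3/4} G e^{3|x|/2} ζ(3/2)(1 + 5q/(2π))` (`G` a uniform Stirling constant for `Γ` on
`1/4 ≤ Re w ≤ 3/2`): `|Γ((s+a_χ)/2)| ≤ G(1+|T|)e^{-π|T|/4}`, `|exp(-u(s-1/2))| = e^{-x(σ-1/2)} e^{πηT/4}`,
`|L_χ(s)| ≤ ζ(3/2)(1 + q(5+|T|)/(2π))` (`WindowAliasing.norm_LFunction_le_linear`). This (unprinted)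
estimate is what makes the shift `Re s = 1/2 → 2` legitimate, and where `|η| < 1` is used.
[cite: Platt2016GRH, Lemma 7.1 p. 3018 (proof)] -/
theorem norm_integrand_le {q : ℕ} [NeZero q] (hq : 1 < q) {χ : DirichletCharacter ℂ q}
    (hχ : χ.IsPrimitive) (ε : ℂ) (η x : ℝ) {G : ℝ} (hG0 : 0 < G)
    (hG : ∀ w : ℂ, 1 / 4 ≤ w.re → w.re ≤ 3 / 2 →
      ‖Complex.Gamma w‖ ≤ G * ((1 + 2 * |w.im|) * Real.exp (-(π / 2 * |w.im|))))
    {s : ℂ} (h1 : 1 / 2 ≤ s.re) (h2 : s.re ≤ 2) :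
    ‖ε * (q : ℂ) ^ ((s - 1 / 2) / 2) * (π : ℂ) ^ (-(s + charParity χ) / 2) *
        Complex.Gamma ((s + charParity χ) / 2) *
        Complex.exp (-(π * η * I / 4 + x) * (s - 1 / 2)) * χ.LFunction s‖ ≤
      ‖ε‖ * (q : ℝ) ^ ((3 : ℝ) / 4) * G * Real.exp (3 / 2 * |x|) *
        (Booker2006Turing.bigZ (3 / 2) * (1 + q * 5 / (2 * π))) *
        ((1 + |s.im|) ^ 2 * Real.exp (-(π * (1 - |η|) / 4 * |s.im|))) := by
  have hA := norm_A_le hq (charParity χ) (charParity_le_one χ) ε η x hG0 hG h1 h2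
  have hT : 0 ≤ |s.im| := abs_nonneg _
  have f6 : ‖χ.LFunction s‖ ≤
      Booker2006Turing.bigZ (3 / 2) * (1 + q * 5 / (2 * π)) * (1 + |s.im|) := by
    have h := WindowAliasing.norm_LFunction_le_linear hq hχ h1 (by linarith)
    have hZ : 0 ≤ Booker2006Turing.bigZ (3 / 2) := (Booker2006Turing.bigZ_pos (by norm_num)).le
    refine h.trans ?_
    rw [mul_assoc]
    refine mul_le_mul_of_nonneg_left ?_ hZ
    have hπ : 0 < 2 * π := by positivity
    have hq0 : (0 : ℝ) ≤ q := Nat.cast_nonneg q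
    rw [← sub_nonneg]
    have : (1 + q * 5 / (2 * π)) * (1 + |s.im|) - (1 + q * (5 + |s.im|) / (2 * π)) =
        |s.im| * (1 + q * 4 / (2 * π)) := by
      field_simp; ring
    rw [this]; positivity
  rw [norm_mul]
  have hK : 0 ≤ ‖ε‖ * (q : ℝ) ^ ((3 : ℝ) / 4) * G * Real.exp (3 / 2 * |x|) := by positivity
  calc _ ≤ (‖ε‖ * (q : ℝ) ^ ((3 : ℝ) / 4) * G * Real.exp (3 / 2 * |x|) *
        ((1 + |s.im|) * Real.exp (-(π * (1 - |η|) / 4 * |s.im|)))) *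
        (Booker2006Turing.bigZ (3 / 2) * (1 + q * 5 / (2 * π)) * (1 + |s.im|)) :=
        mul_le_mul hA f6 (norm_nonneg _) (by positivity)
    _ = _ := by ring

/-- **`Φ_x` is holomorphic on `Re s ≥ 1/2`**: `L_χ` is entire for primitive `χ` with `q > 1`
(Mathlib's `DirichletCharacter.differentiable_LFunction`), `Γ((s+a_χ)/2)` has no pole there, and
`q^{(s-1/2)/2}`, `π^{-(s+a_χ)/2}` are exponentials. [cite: Platt2016GRH, Lemma 7.1 p. 3018 (proof)] -/
theorem differentiableAt_integrand {q : ℕ} [NeZero q] (hq : 1 < q) {χ : DirichletCharacter ℂ q}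
    (hχ : χ.IsPrimitive) (ε : ℂ) (η x : ℝ) {s : ℂ} (h1 : 1 / 2 ≤ s.re) :
    DifferentiableAt ℂ (fun s : ℂ => ε * (q : ℂ) ^ ((s - 1 / 2) / 2) *
        (π : ℂ) ^ (-(s + charParity χ) / 2) * Complex.Gamma ((s + charParity χ) / 2) *
        Complex.exp (-(π * η * I / 4 + x) * (s - 1 / 2)) * χ.LFunction s) s := by
  have hq1 : q ≠ 1 := by omega
  have hχ1 : χ ≠ 1 := SelbergDirichlet.ne_one_of_isPrimitive hq1 hχ
  have hq0 : (q : ℂ) ≠ 0 := by exact_mod_cast (show q ≠ 0 by omega)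
  have hπ0 : (π : ℂ) ≠ 0 := by exact_mod_cast Real.pi_pos.ne'
  have d2 : DifferentiableAt ℂ (fun s : ℂ => (q : ℂ) ^ ((s - 1 / 2) / 2)) s :=
    DifferentiableAt.const_cpow (by fun_prop) (Or.inl hq0)
  have d3 : DifferentiableAt ℂ (fun s : ℂ => (π : ℂ) ^ (-(s + charParity χ) / 2)) s :=
    DifferentiableAt.const_cpow (by fun_prop) (Or.inl hπ0)
  have d4 : DifferentiableAt ℂ (fun s : ℂ => Complex.Gamma ((s + charParity χ) / 2)) s := by
    refine (Complex.differentiableAt_Gamma _ fun m => ?_).comp s (by fun_prop)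
    intro hm
    have := congrArg Complex.re hm
    simp at this
    have h0 : (0 : ℝ) ≤ charParity χ := Nat.cast_nonneg _
    have hm0 : (0 : ℝ) ≤ m := Nat.cast_nonneg _
    linarith
  have d5 : DifferentiableAt ℂ (fun s : ℂ => Complex.exp (-(π * η * I / 4 + x) * (s - 1 / 2))) s := by
    fun_prop
  have d6 : DifferentiableAt ℂ (fun s : ℂ => χ.LFunction s) s :=
    (differentiable_LFunction hχ1).differentiableAt
  exact (((((differentiableAt_const ε).mul d2).mul d3).mul d4).mul d5).mul d6

/-- **`Φ_x` is integrable on every vertical line `Re s = σ`, `1/2 ≤ σ ≤ 2`** (continuity and the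
majorant `FourierTheta.norm_integrand_le`), so both sides of the contour shift are honest Bochner
integrals. [cite: Platt2016GRH, Lemma 7.1 p. 3018 (proof)] -/
theorem integrable_integrand_vertical {q : ℕ} [NeZero q] (hq : 1 < q)
    {χ : DirichletCharacter ℂ q} (hχ : χ.IsPrimitive) (ε : ℂ) {η : ℝ} (hη : |η| < 1) (x : ℝ)
    {σ : ℝ} (h1 : 1 / 2 ≤ σ) (h2 : σ ≤ 2) :
    Integrable fun T : ℝ => (fun s : ℂ => ε * (q : ℂ) ^ ((s - 1 / 2) / 2) *
        (π : ℂ) ^ (-(s + charParity χ) / 2) * Complex.Gamma ((s + charParity χ) / 2) *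
        Complex.exp (-(π * η * I / 4 + x) * (s - 1 / 2)) * χ.LFunction s) ((σ : ℂ) + T * I) := by
  obtain ⟨G, hG0, hG⟩ := exists_norm_Gamma_strip_le
  have hδ : 0 < π * (1 - |η|) / 4 := by nlinarith [Real.pi_pos]
  set K : ℝ := ‖ε‖ * (q : ℝ) ^ ((3 : ℝ) / 4) * G * Real.exp (3 / 2 * |x|) *
        (Booker2006Turing.bigZ (3 / 2) * (1 + q * 5 / (2 * π))) with hK
  have hg := (integrable_one_add_abs_pow_mul_exp 2 hδ).const_mul K
  have hcont : Continuous fun T : ℝ => (fun s : ℂ => ε * (q : ℂ) ^ ((s - 1 / 2) / 2) *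
        (π : ℂ) ^ (-(s + charParity χ) / 2) * Complex.Gamma ((s + charParity χ) / 2) *
        Complex.exp (-(π * η * I / 4 + x) * (s - 1 / 2)) * χ.LFunction s) ((σ : ℂ) + T * I) := by
    have hl : Continuous fun T : ℝ => ((σ : ℂ) + T * I) := by fun_prop
    have hGon : ContinuousOn _ {s : ℂ | 1 / 2 ≤ s.re} := fun s (hs : 1 / 2 ≤ s.re) =>
      (differentiableAt_integrand hq hχ ε η x (s := s) hs).continuousAt.continuousWithinAt
    have hmem : ∀ T : ℝ, ((σ : ℂ) + T * I) ∈ {s : ℂ | 1 / 2 ≤ s.re} := fun T => by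
      simpa using h1
    exact hGon.comp_continuous hl hmem
  refine hg.mono' hcont.aestronglyMeasurable (ae_of_all _ fun T => ?_)
  have hb := norm_integrand_le hq hχ ε η x hG0 hG (s := (σ : ℂ) + T * I) (by simpa using h1)
    (by simpa using h2)
  have hsim : ((σ : ℂ) + T * I).im = T := by simp
  rw [hsim] at hb
  exact hb

/-- **Uniform decay at the top and bottom of the strip:** for every `e > 0`, `‖Φ_x(σ + iT)‖ ≤ e` for all
`σ ∈ [1/2, 2]` once `|T|` is large — the hypothesis of the tree's rectangle-to-strip lemma
`Literature.Analysis.Complex.integral_vertical_eq_of_differentiableOn` performing the printed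
`∫_{Re s = 1/2} = ∫_{Re s = 2}`. [cite: Platt2016GRH, Lemma 7.1 p. 3018 (proof)] -/
theorem decay_integrand {q : ℕ} [NeZero q] (hq : 1 < q) {χ : DirichletCharacter ℂ q}
    (hχ : χ.IsPrimitive) (ε : ℂ) {η : ℝ} (hη : |η| < 1) (x : ℝ) :
    ∀ e : ℝ, 0 < e → ∃ T₀ : ℝ, ∀ T : ℝ, T₀ ≤ |T| → ∀ σ ∈ Icc (1 / 2 : ℝ) 2,
      ‖(fun s : ℂ => ε * (q : ℂ) ^ ((s - 1 / 2) / 2) *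
        (π : ℂ) ^ (-(s + charParity χ) / 2) * Complex.Gamma ((s + charParity χ) / 2) *
        Complex.exp (-(π * η * I / 4 + x) * (s - 1 / 2)) * χ.LFunction s) ((σ : ℂ) + T * I)‖ ≤
        e := by
  intro e he
  obtain ⟨G, hG0, hG⟩ := exists_norm_Gamma_strip_le
  have hδ : 0 < π * (1 - |η|) / 4 := by nlinarith [Real.pi_pos]
  set K : ℝ := ‖ε‖ * (q : ℝ) ^ ((3 : ℝ) / 4) * G * Real.exp (3 / 2 * |x|) *
        (Booker2006Turing.bigZ (3 / 2) * (1 + q * 5 / (2 * π))) with hK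
  obtain ⟨T₀, hT₀⟩ := eventually_one_add_abs_pow_mul_exp_le K 2 hδ he
  refine ⟨T₀, fun T hT σ hσ => ?_⟩
  have hb := norm_integrand_le hq hχ ε η x hG0 hG (s := (σ : ℂ) + T * I) (by simpa using hσ.1)
    (by simpa using hσ.2)
  have hsim : ((σ : ℂ) + T * I).im = T := by simp
  rw [hsim] at hb
  exact hb.trans (hT₀ T hT)

/-! ## §4 The line `Re s = 1/2` -/

/-- **"Writing `s = 1/2 + it`"** (p. 3018): the Fourier integrand `F(t, χ) e^{-ixt}` of `F̂(x, χ)`,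
`F(t, χ) = ε q^{it/2} π^{-(1/2+a_χ+it)/2} Γ((1/2+a_χ+it)/2) e^{πηt/4} L_χ(1/2+it)` (p. 3017), IS `Φ_x(1/2+it)`:
`q^{it/2} = q^{(s-1/2)/2}` and `e^{πηt/4} e^{-ixt} = exp(-(πηi + 4x)(s-1/2)/4) = exp(-u(x)(s-1/2))`.
[cite: Platt2016GRH, Lemma 7.1 p. 3018 (proof)] -/
theorem fourier_integrand_eq {q : ℕ} [NeZero q] (χ : DirichletCharacter ℂ q) (ε : ℂ) (η x t : ℝ) :
    ε * (q : ℂ) ^ (I * t / 2) * (π : ℂ) ^ (-(1 / 2 + charParity χ + I * t) / 2) *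
        Complex.Gamma ((1 / 2 + charParity χ + I * t) / 2) * Complex.exp (π * η * t / 4) *
        χ.LFunction (1 / 2 + I * t) * Complex.exp (-I * x * t) =
      (fun s : ℂ => ε * (q : ℂ) ^ ((s - 1 / 2) / 2) *
        (π : ℂ) ^ (-(s + charParity χ) / 2) * Complex.Gamma ((s + charParity χ) / 2) *
        Complex.exp (-(π * η * I / 4 + x) * (s - 1 / 2)) * χ.LFunction s) ((((1 / 2 : ℝ)) : ℂ) + t * I) := by
  have e0 : ((((1 / 2 : ℝ)) : ℂ) + t * I) = 1 / 2 + t * I := by push_cast; ring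
  simp only [e0]
  have e1 : ((1 / 2 + (t : ℂ) * I) - 1 / 2) / 2 = I * t / 2 := by ring
  have e2 : -((1 / 2 + (t : ℂ) * I) + (charParity χ : ℂ)) / 2 =
      -(1 / 2 + charParity χ + I * t) / 2 := by ring
  have e3 : ((1 / 2 + (t : ℂ) * I) + (charParity χ : ℂ)) / 2 =
      (1 / 2 + charParity χ + I * t) / 2 := by ring
  have e4 : -((π : ℂ) * η * I / 4 + x) * ((1 / 2 + (t : ℂ) * I) - 1 / 2) =
      (π * η * t / 4 : ℂ) + (-I * x * t) := by
    have : -((π : ℂ) * η * I / 4 + x) * ((1 / 2 + (t : ℂ) * I) - 1 / 2) =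
        -(I * I) * (π * η * t / 4) + -I * x * t := by ring
    rw [this, Complex.I_mul_I]; ring
  rw [e1, e2, e3, e4, Complex.exp_add]
  ring

/-! ## §5 The line `Re s = 2`: Dirichlet series and the Cahen–Mellin integral term by term -/

/-- `Re(πn² e^{2u}/q) > 0` for `n ≥ 1`, `|η| < 1` (`arg = πη/2`). [folklore] -/
private theorem re_z_pos {q : ℕ} (hq : 1 < q) {η : ℝ} (hη : |η| < 1) (x : ℝ) {n : ℕ} (hn : n ≠ 0) :
    0 < ((π * n ^ 2 * Complex.exp (2 * (π * η * I / 4 + x)) / q : ℂ)).re := by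
  have hnpos : (0 : ℝ) < n := by exact_mod_cast Nat.pos_of_ne_zero hn
  have hqpos : (0 : ℝ) < q := by exact_mod_cast (show 0 < q by omega)
  have hr : 0 < π * n ^ 2 / q := by positivity
  have hz : ((π * n ^ 2 * Complex.exp (2 * (π * η * I / 4 + x)) / q : ℂ)) =
      ((π * n ^ 2 / q : ℝ) : ℂ) * Complex.exp (2 * (π * η * I / 4 + x)) := by
    push_cast; ring
  have him : (2 * ((π : ℂ) * η * I / 4 + x)).im = π * η / 2 := by simp; ring
  have hre : (2 * ((π : ℂ) * η * I / 4 + x)).re = 2 * x := by simp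
  rw [hz, Complex.re_ofReal_mul, Complex.exp_re, him, hre]
  have hcos : 0 < Real.cos (π * η / 2) := by
    apply Real.cos_pos_of_mem_Ioo
    constructor <;> nlinarith [Real.pi_pos, abs_lt.mp hη]
  positivity

/-- Principal logarithm: `log(πn² e^{2u}/q) = log(πn²/q) + 2u` since `|Im 2u| = π|η|/2 < π`. [folklore] -/
private theorem log_z_eq {q : ℕ} (hq : 1 < q) {η : ℝ} (hη : |η| < 1) (x : ℝ) {n : ℕ} (hn : n ≠ 0) :
    Complex.log ((π * n ^ 2 * Complex.exp (2 * (π * η * I / 4 + x)) / q : ℂ)) =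
      ((Real.log π + 2 * Real.log n - Real.log q : ℝ) : ℂ) + 2 * (π * η * I / 4 + x) := by
  have hnpos : (0 : ℝ) < n := by exact_mod_cast Nat.pos_of_ne_zero hn
  have hqpos : (0 : ℝ) < q := by exact_mod_cast (show 0 < q by omega)
  have hr : 0 < π * n ^ 2 / q := by positivity
  have hz : ((π * n ^ 2 * Complex.exp (2 * (π * η * I / 4 + x)) / q : ℂ)) =
      ((π * n ^ 2 / q : ℝ) : ℂ) * Complex.exp (2 * (π * η * I / 4 + x)) := by
    push_cast; ring
  have him : (2 * ((π : ℂ) * η * I / 4 + x)).im = π * η / 2 := by simp; ring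
  have hlt := abs_lt.mp hη
  rw [hz, Complex.log_ofReal_mul hr (Complex.exp_ne_zero _),
    Complex.log_exp (by rw [him]; nlinarith [Real.pi_pos]) (by rw [him]; nlinarith [Real.pi_pos]),
    Real.log_div (by positivity) hqpos.ne', Real.log_mul Real.pi_pos.ne' (by positivity),
    Real.log_pow]
  push_cast
  ring

/-- **The third and fourth displayed equalities of the printed proof, term by term on `Re s = 2`:**
for `n ≥ 1` and `s = 2 + it`,
`ε q^{(s-1/2)/2} π^{-(s+a)/2} Γ((s+a)/2) e^{-u(s-1/2)} · χ(n) n^{-s}`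
`= ε χ(n) n^a e^{(1/2+a)u} q^{-(1/2+a)/2} · Γ(c + iy) z_n^{-(c+iy)}` with `c = 1 + a/2`, `y = t/2`,
`z_n = πn² e^{2u}/q` (principal branch, `FourierTheta.log_z_eq`) — for `a = 0` this is
`(ε e^{u/2}/q^{1/4}) χ(n) (πn²/q)^{-s/2} Γ(s/2) exp(2u)^{-s/2}`. [cite: Platt2016GRH, Lemma 7.1 p. 3018 (proof)] -/
theorem farLine_term_eq {q : ℕ} [NeZero q] (hq : 1 < q) (χ : DirichletCharacter ℂ q) (ε : ℂ)
    {η : ℝ} (hη : |η| < 1) (x t : ℝ) {n : ℕ} (hn : n ≠ 0) :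
    ε * (q : ℂ) ^ ((((2 : ℝ) : ℂ) + t * I - 1 / 2) / 2) *
        (π : ℂ) ^ (-(((2 : ℝ) : ℂ) + t * I + charParity χ) / 2) *
        Complex.Gamma ((((2 : ℝ) : ℂ) + t * I + charParity χ) / 2) *
        Complex.exp (-(π * η * I / 4 + x) * (((2 : ℝ) : ℂ) + t * I - 1 / 2)) *
        LSeries.term (fun n => χ n) (((2 : ℝ) : ℂ) + t * I) n =
      ε * χ n * (n : ℂ) ^ charParity χ * Complex.exp ((1 / 2 + charParity χ) * (π * η * I / 4 + x)) *
        (q : ℂ) ^ (-((1 / 2 + charParity χ) / 2) : ℂ) *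
        (Complex.Gamma ((((1 + (charParity χ : ℝ) / 2 : ℝ)) : ℂ) + ((t / 2 : ℝ) : ℂ) * I) *
          ((π * n ^ 2 * Complex.exp (2 * (π * η * I / 4 + x)) / q : ℂ)) ^
            (-((((1 + (charParity χ : ℝ) / 2 : ℝ)) : ℂ) + ((t / 2 : ℝ) : ℂ) * I))) := by
  have lz := log_z_eq hq hη x hn
  have hz0 : ((π * n ^ 2 * Complex.exp (2 * (π * η * I / 4 + x)) / q : ℂ)) ≠ 0 := by
    intro h; have := re_z_pos hq hη x hn; rw [h] at this; simp at this
  have e0 : (((2 : ℝ) : ℂ) + t * I) = 2 + t * I := by push_cast; ring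
  simp only [e0]
  set a : ℕ := charParity χ with ha
  set u : ℂ := π * η * I / 4 + x with hu
  set z : ℂ := π * n ^ 2 * Complex.exp (2 * u) / q with hz
  have hn0 : (n : ℂ) ≠ 0 := by exact_mod_cast hn
  have hnpos : (0 : ℝ) < n := by exact_mod_cast Nat.pos_of_ne_zero hn
  have hq0 : (q : ℂ) ≠ 0 := by exact_mod_cast (show q ≠ 0 by omega)
  have hqpos : (0 : ℝ) < q := by exact_mod_cast (show 0 < q by omega)
  have hπ0 : (π : ℂ) ≠ 0 := by exact_mod_cast Real.pi_pos.ne'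
  have lq : Complex.log (q : ℂ) = ((Real.log q : ℝ) : ℂ) := by
    rw [show (q : ℂ) = ((q : ℝ) : ℂ) by simp, ← Complex.ofReal_log hqpos.le]
  have lπ : Complex.log (π : ℂ) = ((Real.log π : ℝ) : ℂ) :=
    (Complex.ofReal_log Real.pi_pos.le).symm
  have ln : Complex.log (n : ℂ) = ((Real.log n : ℝ) : ℂ) := by
    rw [show (n : ℂ) = ((n : ℝ) : ℂ) by simp, ← Complex.ofReal_log hnpos.le]
  have f1 : (q : ℂ) ^ ((2 + t * I - 1 / 2) / 2) =
      Complex.exp (((Real.log q : ℝ) : ℂ) * ((2 + t * I - 1 / 2) / 2)) := by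
    rw [Complex.cpow_def_of_ne_zero hq0, lq]
  have f2 : (π : ℂ) ^ (-(2 + t * I + a) / 2) =
      Complex.exp (((Real.log π : ℝ) : ℂ) * (-(2 + t * I + a) / 2)) := by
    rw [Complex.cpow_def_of_ne_zero hπ0, lπ]
  have f3 : LSeries.term (fun n => χ n) (2 + t * I) n =
      χ n * Complex.exp (-(((Real.log n : ℝ) : ℂ) * (2 + t * I))) := by
    rw [LSeries.term_of_ne_zero hn, div_eq_mul_inv, Complex.cpow_def_of_ne_zero hn0, ln,
      ← Complex.exp_neg]
  have f4 : ((n : ℂ)) ^ a = Complex.exp (((Real.log n : ℝ) : ℂ) * a) := by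
    rw [← Complex.cpow_natCast, Complex.cpow_def_of_ne_zero hn0, ln]
  have f5 : (q : ℂ) ^ (-((1 / 2 + a) / 2) : ℂ) =
      Complex.exp (((Real.log q : ℝ) : ℂ) * (-((1 / 2 + a) / 2))) := by
    rw [Complex.cpow_def_of_ne_zero hq0, lq]
  have f6 : z ^ (-((((1 + (a : ℝ) / 2 : ℝ)) : ℂ) + ((t / 2 : ℝ) : ℂ) * I)) =
      Complex.exp (Complex.log z * (-((((1 + (a : ℝ) / 2 : ℝ)) : ℂ) + ((t / 2 : ℝ) : ℂ) * I))) := by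
    rw [Complex.cpow_def_of_ne_zero hz0]
  have g_eq : Complex.Gamma ((2 + t * I + a) / 2) =
      Complex.Gamma ((((1 + (a : ℝ) / 2 : ℝ)) : ℂ) + ((t / 2 : ℝ) : ℂ) * I) := by
    congr 1; push_cast; ring
  rw [f1, f2, f3, f4, f5, f6, lz, g_eq]
  have key : Complex.exp (((Real.log q : ℝ) : ℂ) * ((2 + t * I - 1 / 2) / 2)) *
      Complex.exp (((Real.log π : ℝ) : ℂ) * (-(2 + t * I + a) / 2)) *
      Complex.exp (-u * (2 + t * I - 1 / 2)) *
      Complex.exp (-(((Real.log n : ℝ) : ℂ) * (2 + t * I))) =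
      Complex.exp (((Real.log n : ℝ) : ℂ) * a) * Complex.exp ((1 / 2 + a) * u) *
      Complex.exp (((Real.log q : ℝ) : ℂ) * (-((1 / 2 + a) / 2))) *
      Complex.exp ((((Real.log π + 2 * Real.log n - Real.log q : ℝ) : ℂ) + 2 * u) *
        (-((((1 + (a : ℝ) / 2 : ℝ)) : ℂ) + ((t / 2 : ℝ) : ℂ) * I))) := by
    simp only [← Complex.exp_add]
    congr 1
    push_cast
    ring
  linear_combination (ε * χ n * Complex.Gamma ((((1 + (a : ℝ) / 2 : ℝ)) : ℂ) + ((t / 2 : ℝ) : ℂ) * I)) * key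

/-- **The last displayed equality of the printed proof, term by term:**
`∫ (ε q^{(s-1/2)/2} π^{-(s+a)/2} Γ((s+a)/2) e^{-u(s-1/2)} χ(n) n^{-s})|_{s = 2+it} dt`
`= 2π · 2 ε e^{(1/2+a)u} q^{-(1/2+a)/2} · n^a χ(n) exp(-πn² e^{2u}/q)` — the Cahen–Mellin integral
`(1/2πi) ∫_{(c)} Γ(w) z^{-w} dw = e^{-z}` in the sector `Re z > 0` (the tree's
`Literature.Analysis.Complex.integral_Gamma_mul_cpow_neg_eq`) after `t = 2y`; the `n = 0` term is `0`
on both sides (`χ(0) = 0`, `q > 1`). [cite: Platt2016GRH, Lemma 7.1 p. 3018 (proof)] -/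
theorem integral_farLine_term {q : ℕ} [NeZero q] (hq : 1 < q) (χ : DirichletCharacter ℂ q) (ε : ℂ)
    {η : ℝ} (hη : |η| < 1) (x : ℝ) (n : ℕ) :
    ∫ t : ℝ, ε * (q : ℂ) ^ ((((2 : ℝ) : ℂ) + t * I - 1 / 2) / 2) *
        (π : ℂ) ^ (-(((2 : ℝ) : ℂ) + t * I + charParity χ) / 2) *
        Complex.Gamma ((((2 : ℝ) : ℂ) + t * I + charParity χ) / 2) *
        Complex.exp (-(π * η * I / 4 + x) * (((2 : ℝ) : ℂ) + t * I - 1 / 2)) *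
        LSeries.term (fun n => χ n) (((2 : ℝ) : ℂ) + t * I) n =
      2 * π * (2 * ε * Complex.exp ((1 / 2 + charParity χ) * (π * η * I / 4 + x)) *
        (q : ℂ) ^ (-((1 / 2 + charParity χ) / 2) : ℂ) *
        (χ n * (n : ℂ) ^ charParity χ *
          Complex.exp (-(π * n ^ 2 * Complex.exp (2 * (π * η * I / 4 + x)) / q)))) := by
  haveI : Fact (1 < q) := ⟨hq⟩
  rcases eq_or_ne n 0 with rfl | hn
  · have h0 : χ (0 : ZMod q) = 0 := MulChar.map_zero χ
    simp [LSeries.term_zero, h0]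
  have hc : 0 < (1 + (charParity χ : ℝ) / 2) := by positivity
  have hzre := re_z_pos hq hη x hn
  simp_rw [farLine_term_eq hq χ ε hη x _ hn]
  rw [integral_const_mul]
  have hg := Measure.integral_comp_div (fun y : ℝ =>
    Complex.Gamma ((((1 + (charParity χ : ℝ) / 2 : ℝ)) : ℂ) + (y : ℂ) * I) *
      ((π * n ^ 2 * Complex.exp (2 * (π * η * I / 4 + x)) / q : ℂ)) ^
        (-((((1 + (charParity χ : ℝ) / 2 : ℝ)) : ℂ) + (y : ℂ) * I))) 2
  rw [hg, Literature.Analysis.Complex.integral_Gamma_mul_cpow_neg_eq hc hzre, abs_two,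
    Complex.real_smul]
  push_cast
  ring

/-- Majorant of the `n`-th term on `Re s = 2`: `≤ ‖ε‖ q^{3/4} G e^{3|x|/2} (1+|t|) e^{-π(1-|η|)|t|/4} / n²`.
[folklore] -/
private theorem norm_farLine_term_le {q : ℕ} [NeZero q] (hq : 1 < q) (χ : DirichletCharacter ℂ q) (ε : ℂ)
    (η x : ℝ) {G : ℝ} (hG0 : 0 < G)
    (hG : ∀ w : ℂ, 1 / 4 ≤ w.re → w.re ≤ 3 / 2 →
      ‖Complex.Gamma w‖ ≤ G * ((1 + 2 * |w.im|) * Real.exp (-(π / 2 * |w.im|))))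
    (t : ℝ) (n : ℕ) :
    ‖ε * (q : ℂ) ^ ((((2 : ℝ) : ℂ) + t * I - 1 / 2) / 2) *
        (π : ℂ) ^ (-(((2 : ℝ) : ℂ) + t * I + charParity χ) / 2) *
        Complex.Gamma ((((2 : ℝ) : ℂ) + t * I + charParity χ) / 2) *
        Complex.exp (-(π * η * I / 4 + x) * (((2 : ℝ) : ℂ) + t * I - 1 / 2)) *
        LSeries.term (fun n => χ n) (((2 : ℝ) : ℂ) + t * I) n‖ ≤
      ‖ε‖ * (q : ℝ) ^ ((3 : ℝ) / 4) * G * Real.exp (3 / 2 * |x|) *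
        ((1 + |t|) * Real.exp (-(π * (1 - |η|) / 4 * |t|))) * (1 / (n : ℝ) ^ 2) := by
  rcases eq_or_ne n 0 with rfl | hn
  · simp [LSeries.term_zero]
  have hA := norm_A_le hq (charParity χ) (charParity_le_one χ) ε η x hG0 hG
    (s := ((2 : ℝ) : ℂ) + t * I) (by simp; norm_num) (by simp)
  have hsim : (((2 : ℝ) : ℂ) + t * I).im = t := by simp
  rw [hsim] at hA
  have hterm : ‖LSeries.term (fun n => χ n) (((2 : ℝ) : ℂ) + t * I) n‖ ≤ 1 / (n : ℝ) ^ 2 := by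
    rw [LSeries.norm_term_eq, if_neg hn]
    have hre : (((2 : ℝ) : ℂ) + t * I).re = 2 := by simp
    rw [hre, Real.rpow_two]
    exact div_le_div_of_nonneg_right (DirichletCharacter.norm_le_one χ _) (by positivity)
  rw [norm_mul]
  exact mul_le_mul hA hterm (norm_nonneg _) (by positivity)

/-- Each term of the Dirichlet series of `Φ_x` on `Re s = 2` is integrable in `t` (continuity via
`FourierTheta.farLine_term_eq`, majorant `≪ (1+|t|) e^{-π(1-|η|)|t|/4}/n²`) — first half of the
justification of "`∫ Σ = Σ ∫`" in the printed proof. [cite: Platt2016GRH, Lemma 7.1 p. 3018 (proof)] -/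
theorem integrable_farLine_term {q : ℕ} [NeZero q] (hq : 1 < q) (χ : DirichletCharacter ℂ q)
    (ε : ℂ) {η : ℝ} (hη : |η| < 1) (x : ℝ) (n : ℕ) :
    Integrable fun t : ℝ => ε * (q : ℂ) ^ ((((2 : ℝ) : ℂ) + t * I - 1 / 2) / 2) *
        (π : ℂ) ^ (-(((2 : ℝ) : ℂ) + t * I + charParity χ) / 2) *
        Complex.Gamma ((((2 : ℝ) : ℂ) + t * I + charParity χ) / 2) *
        Complex.exp (-(π * η * I / 4 + x) * (((2 : ℝ) : ℂ) + t * I - 1 / 2)) *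
        LSeries.term (fun n => χ n) (((2 : ℝ) : ℂ) + t * I) n := by
  rcases eq_or_ne n 0 with rfl | hn
  · simp [LSeries.term_zero]
  obtain ⟨G, hG0, hG⟩ := exists_norm_Gamma_strip_le
  have hδ : 0 < π * (1 - |η|) / 4 := by nlinarith [Real.pi_pos]
  have hc : 0 < (1 + (charParity χ : ℝ) / 2) := by positivity
  have hz0 : ((π * n ^ 2 * Complex.exp (2 * (π * η * I / 4 + x)) / q : ℂ)) ≠ 0 := by
    intro h; have := re_z_pos hq hη x hn; rw [h] at this; simp at this
  have hcont : Continuous fun t : ℝ => ε * (q : ℂ) ^ ((((2 : ℝ) : ℂ) + t * I - 1 / 2) / 2) *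
        (π : ℂ) ^ (-(((2 : ℝ) : ℂ) + t * I + charParity χ) / 2) *
        Complex.Gamma ((((2 : ℝ) : ℂ) + t * I + charParity χ) / 2) *
        Complex.exp (-(π * η * I / 4 + x) * (((2 : ℝ) : ℂ) + t * I - 1 / 2)) *
        LSeries.term (fun n => χ n) (((2 : ℝ) : ℂ) + t * I) n := by
    have heq : (fun t : ℝ => ε * (q : ℂ) ^ ((((2 : ℝ) : ℂ) + t * I - 1 / 2) / 2) *
        (π : ℂ) ^ (-(((2 : ℝ) : ℂ) + t * I + charParity χ) / 2) *
        Complex.Gamma ((((2 : ℝ) : ℂ) + t * I + charParity χ) / 2) *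
        Complex.exp (-(π * η * I / 4 + x) * (((2 : ℝ) : ℂ) + t * I - 1 / 2)) *
        LSeries.term (fun n => χ n) (((2 : ℝ) : ℂ) + t * I) n) = fun t : ℝ =>
      ε * χ n * (n : ℂ) ^ charParity χ * Complex.exp ((1 / 2 + charParity χ) * (π * η * I / 4 + x)) *
        (q : ℂ) ^ (-((1 / 2 + charParity χ) / 2) : ℂ) *
        (Complex.Gamma ((((1 + (charParity χ : ℝ) / 2 : ℝ)) : ℂ) + ((t / 2 : ℝ) : ℂ) * I) *
          ((π * n ^ 2 * Complex.exp (2 * (π * η * I / 4 + x)) / q : ℂ)) ^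
            (-((((1 + (charParity χ : ℝ) / 2 : ℝ)) : ℂ) + ((t / 2 : ℝ) : ℂ) * I))) :=
      funext fun t => farLine_term_eq hq χ ε hη x t hn
    rw [heq]
    exact continuous_const.mul
      ((Literature.Analysis.Complex.continuous_Gamma_mul_cpow_neg hc hz0).comp' (by fun_prop))
  have hg := ((integrable_one_add_abs_pow_mul_exp 1 hδ).const_mul
    (‖ε‖ * (q : ℝ) ^ ((3 : ℝ) / 4) * G * Real.exp (3 / 2 * |x|))).mul_const (1 / (n : ℝ) ^ 2)
  refine hg.mono' hcont.aestronglyMeasurable (ae_of_all _ fun t => ?_)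
  have h := norm_farLine_term_le hq χ ε η x hG0 hG t n
  simpa [pow_one] using h

/-- `Σ_n ∫ ‖n-th term‖ dt < ∞` on `Re s = 2` (`≪ Σ n^{-2}`) — second half of the justification of
"`∫ Σ = Σ ∫`" (Mathlib's `integral_tsum_of_summable_integral_norm`). [cite: Platt2016GRH, Lemma 7.1 p. 3018 (proof)] -/
theorem summable_integral_norm_farLine_term {q : ℕ} [NeZero q] (hq : 1 < q)
    (χ : DirichletCharacter ℂ q) (ε : ℂ) {η : ℝ} (hη : |η| < 1) (x : ℝ) :
    Summable fun n : ℕ => ∫ t : ℝ, ‖ε * (q : ℂ) ^ ((((2 : ℝ) : ℂ) + t * I - 1 / 2) / 2) *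
        (π : ℂ) ^ (-(((2 : ℝ) : ℂ) + t * I + charParity χ) / 2) *
        Complex.Gamma ((((2 : ℝ) : ℂ) + t * I + charParity χ) / 2) *
        Complex.exp (-(π * η * I / 4 + x) * (((2 : ℝ) : ℂ) + t * I - 1 / 2)) *
        LSeries.term (fun n => χ n) (((2 : ℝ) : ℂ) + t * I) n‖ := by
  obtain ⟨G, hG0, hG⟩ := exists_norm_Gamma_strip_le
  have hδ : 0 < π * (1 - |η|) / 4 := by nlinarith [Real.pi_pos]
  have hMi : Integrable fun t : ℝ => ‖ε‖ * (q : ℝ) ^ ((3 : ℝ) / 4) * G * Real.exp (3 / 2 * |x|) *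
      ((1 + |t|) * Real.exp (-(π * (1 - |η|) / 4 * |t|))) := by
    have := (integrable_one_add_abs_pow_mul_exp 1 hδ).const_mul
      (‖ε‖ * (q : ℝ) ^ ((3 : ℝ) / 4) * G * Real.exp (3 / 2 * |x|))
    simpa [pow_one] using this
  refine Summable.of_nonneg_of_le (fun n => integral_nonneg fun t => norm_nonneg _) (fun n => ?_)
    ((Real.summable_one_div_nat_pow.mpr one_lt_two).mul_left
      (∫ t : ℝ, ‖ε‖ * (q : ℝ) ^ ((3 : ℝ) / 4) * G * Real.exp (3 / 2 * |x|) *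
        ((1 + |t|) * Real.exp (-(π * (1 - |η|) / 4 * |t|)))))
  rw [← integral_mul_const]
  exact integral_mono_of_nonneg (ae_of_all _ fun t => norm_nonneg _) (hMi.mul_const _)
    (ae_of_all _ fun t => norm_farLine_term_le hq χ ε η x hG0 hG t n)

end FourierTheta

open FourierTheta

/-! ## §6 Lemmas 7.1 and 7.2 -/

/-- **Platt 2016, Lemmas 7.1 and 7.2 together (Math. Comp. 85, p. 3018), over the parity
`a = a_χ = charParity χ ∈ {0, 1}`:** for `χ` primitive mod `q > 1`, `η ∈ (-1, 1)`, `x ∈ ℝ`, `ε ∈ ℂ` and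
`u(x) = πηi/4 + x`,
`(1/(2π)) ∫ F(t, χ) e^{-ixt} dt = 2 ε e^{(1/2+a)u(x)} q^{-(1/2+a)/2} Σ_n n^a χ(n) exp(-πn² exp(2u(x))/q)`,
where `F(t, χ) = ε q^{it/2} π^{-(1/2+a+it)/2} Γ((1/2+a+it)/2) exp(πηt/4) L_χ(1/2+it)` is Platt's `F_e`
(`a = 0`) / `F_o` (`a = 1`) of p. 3017, written out over Mathlib's `DirichletCharacter.LFunction` and
`Complex.Gamma`; the sum over `n : ℕ` has vanishing `n = 0` term (`χ(0) = 0`). Proof = the printed one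
(module docstring): `FourierTheta.fourier_integrand_eq` (the line `Re s = 1/2`), the shift to `Re s = 2`
(`integral_vertical_eq_of_differentiableOn` with `FourierTheta.differentiableAt_integrand`,
`integrable_integrand_vertical`, `decay_integrand`), the Dirichlet series of `L_χ` on `Re s = 2`
(Mathlib's `LFunction_eq_LSeries`), `∫ Σ = Σ ∫` (`FourierTheta.integrable_farLine_term`,
`summable_integral_norm_farLine_term`) and the termwise Cahen–Mellin evaluation
(`FourierTheta.integral_farLine_term`). [cite: Platt2016GRH, Lemmas 7.1–7.2 p. 3018] -/
theorem platt2016_lemma71_72 {q : ℕ} [NeZero q] (hq : 1 < q) {χ : DirichletCharacter ℂ q}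
    (hχ : χ.IsPrimitive) (ε : ℂ) {η : ℝ} (hη : |η| < 1) (x : ℝ) :
    1 / (2 * π) * ∫ t : ℝ, ε * (q : ℂ) ^ (I * t / 2) * (π : ℂ) ^ (-(1 / 2 + charParity χ + I * t) / 2) *
        Complex.Gamma ((1 / 2 + charParity χ + I * t) / 2) * Complex.exp (π * η * t / 4) *
        χ.LFunction (1 / 2 + I * t) * Complex.exp (-I * x * t) =
      2 * ε * Complex.exp ((1 / 2 + charParity χ) * (π * η * I / 4 + x)) *
        (q : ℂ) ^ (-((1 / 2 + charParity χ) / 2) : ℂ) *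
        ∑' n : ℕ, (χ n * (n : ℂ) ^ charParity χ *
          Complex.exp (-(π * n ^ 2 * Complex.exp (2 * (π * η * I / 4 + x)) / q))) := by
  have hπ0 : (π : ℂ) ≠ 0 := by exact_mod_cast Real.pi_pos.ne'
  have hab : (1 / 2 : ℝ) ≤ 2 := by norm_num
  have h1 := integral_congr_ae (ae_of_all (volume : Measure ℝ) fun t =>
    fourier_integrand_eq χ ε η x t)
  have hshift := Literature.Analysis.Complex.integral_vertical_eq_of_differentiableOn
    (F := (fun s : ℂ => ε * (q : ℂ) ^ ((s - 1 / 2) / 2) *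
        (π : ℂ) ^ (-(s + charParity χ) / 2) * Complex.Gamma ((s + charParity χ) / 2) *
        Complex.exp (-(π * η * I / 4 + x) * (s - 1 / 2)) * χ.LFunction s))
    (a := 1 / 2) (b := 2) hab
    (fun s hs => (differentiableAt_integrand hq hχ ε η x (s := s) hs.1).differentiableWithinAt)
    (integrable_integrand_vertical hq hχ ε hη x (σ := 1 / 2) le_rfl hab)
    (integrable_integrand_vertical hq hχ ε hη x (σ := 2) hab le_rfl)
    (decay_integrand hq hχ ε hη x)
  have hI := h1.trans hshift
  rw [hI]
  -- on the far line: expand the Dirichlet series and integrate term by term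
  have hLt : ∀ t : ℝ, ε * (q : ℂ) ^ ((((2 : ℝ) : ℂ) + t * I - 1 / 2) / 2) *
        (π : ℂ) ^ (-(((2 : ℝ) : ℂ) + t * I + charParity χ) / 2) *
        Complex.Gamma ((((2 : ℝ) : ℂ) + t * I + charParity χ) / 2) *
        Complex.exp (-(π * η * I / 4 + x) * (((2 : ℝ) : ℂ) + t * I - 1 / 2)) *
        χ.LFunction (((2 : ℝ) : ℂ) + t * I) =
      ∑' n : ℕ, ε * (q : ℂ) ^ ((((2 : ℝ) : ℂ) + t * I - 1 / 2) / 2) *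
        (π : ℂ) ^ (-(((2 : ℝ) : ℂ) + t * I + charParity χ) / 2) *
        Complex.Gamma ((((2 : ℝ) : ℂ) + t * I + charParity χ) / 2) *
        Complex.exp (-(π * η * I / 4 + x) * (((2 : ℝ) : ℂ) + t * I - 1 / 2)) *
        LSeries.term (fun n => χ n) (((2 : ℝ) : ℂ) + t * I) n := fun t => by
    rw [DirichletCharacter.LFunction_eq_LSeries χ (by simp), LSeries]
    exact tsum_mul_left.symm
  simp_rw [hLt]
  rw [← integral_tsum_of_summable_integral_norm (integrable_farLine_term hq χ ε hη x)
    (summable_integral_norm_farLine_term hq χ ε hη x)]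
  simp_rw [integral_farLine_term hq χ ε hη x]
  rw [tsum_mul_left, tsum_mul_left, ← mul_assoc,
    show (1 / (2 * π) : ℂ) * (2 * π) = 1 by field_simp, one_mul]

/-- **Platt 2016, Lemma 7.1 (Math. Comp. 85, p. 3018; arXiv:1305.3087v1 Lemma 5.1), as printed:**
"Let `x ∈ ℝ`, `η ∈ (-1, 1)` and `u(x) := πηi/4 + x`. Then we have
`F̂_e(x, χ) = (2 ε_χ exp(u(x)/2) / q^{1/4}) Σ_{n=1}^∞ χ(n) exp(-πn² exp(2u(x))/q)`."
Here `χ` is an even primitive character mod `q > 1`,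
`F_e(t, χ) = ε_χ q^{it/2} π^{-(1/2+it)/2} Γ((1/2+it)/2) exp(πηt/4) L_χ(1/2+it)` and
`F̂_e(x, χ) = (1/(2π)) ∫_{-∞}^{∞} F_e(t, χ) e^{-ixt} dt` (p. 3017), written out over Mathlib's
`DirichletCharacter.LFunction`/`Complex.Gamma` (`q^{1/4}` = principal `cpow`); any `ε_χ ∈ ℂ` (Platt:
`|ε_χ| = 1`); the sum over `n : ℕ` has vanishing `n = 0` term. The case `a_χ = 0` of
`platt2016_lemma71_72`. [cite: Platt2016GRH, Lemma 7.1 p. 3018] -/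
theorem platt2016_lemma71 {q : ℕ} [NeZero q] (hq : 1 < q) {χ : DirichletCharacter ℂ q}
    (hχ : χ.IsPrimitive) (hχe : χ.Even) (ε : ℂ) {η : ℝ} (hη : |η| < 1) (x : ℝ) :
    1 / (2 * π) * ∫ t : ℝ, ε * (q : ℂ) ^ (I * t / 2) * (π : ℂ) ^ (-(1 / 2 + I * t) / 2) *
        Complex.Gamma ((1 / 2 + I * t) / 2) * Complex.exp (π * η * t / 4) *
        χ.LFunction (1 / 2 + I * t) * Complex.exp (-I * x * t) =
      2 * ε * Complex.exp ((π * η * I / 4 + x) / 2) / (q : ℂ) ^ (1 / 4 : ℂ) *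
        ∑' n : ℕ, χ n * Complex.exp (-(π * n ^ 2 * Complex.exp (2 * (π * η * I / 4 + x)) / q)) := by
  have h := platt2016_lemma71_72 hq hχ ε hη x
  rw [charParity_of_even hχe] at h
  simp only [Nat.cast_zero, add_zero, pow_zero, mul_one] at h
  rw [h]
  have e1 : (1 / 2 : ℂ) * (π * η * I / 4 + x) = (π * η * I / 4 + x) / 2 := by ring
  have e2 : (q : ℂ) ^ (-(1 / 2 / 2) : ℂ) = 1 / (q : ℂ) ^ (1 / 4 : ℂ) := by
    rw [Complex.cpow_neg, one_div]; norm_num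
  rw [e1, e2]
  ring

/-- **Platt 2016, Lemma 7.2 (Math. Comp. 85, p. 3018; arXiv:1305.3087v1 Lemma 5.2), as printed:**
"Let `x`, `η` and `u(x)` be as defined in Lemma 7.1. Then we have
`F̂_o(x, χ) = (2 ε_χ exp(3u(x)/2) / q^{3/4}) Σ_{n=1}^∞ n χ(n) exp(-πn² exp(2u(x))/q)`."
Here `χ` is an odd primitive character mod `q > 1`,
`F_o(t, χ) = ε_χ q^{it/2} π^{-(3/2+it)/2} Γ((3/2+it)/2) exp(πηt/4) L_χ(1/2+it)` and
`F̂_o(x, χ) = (1/(2π)) ∫ F_o(t, χ) e^{-ixt} dt` (p. 3017); conventions as in `platt2016_lemma71`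
(the summand is written `χ(n) · n · exp(…)`). The case `a_χ = 1` of `platt2016_lemma71_72` ("the proof
follows the same lines", p. 3018). [cite: Platt2016GRH, Lemma 7.2 p. 3018] -/
theorem platt2016_lemma72 {q : ℕ} [NeZero q] (hq : 1 < q) {χ : DirichletCharacter ℂ q}
    (hχ : χ.IsPrimitive) (hχo : χ.Odd) (ε : ℂ) {η : ℝ} (hη : |η| < 1) (x : ℝ) :
    1 / (2 * π) * ∫ t : ℝ, ε * (q : ℂ) ^ (I * t / 2) * (π : ℂ) ^ (-(3 / 2 + I * t) / 2) *
        Complex.Gamma ((3 / 2 + I * t) / 2) * Complex.exp (π * η * t / 4) *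
        χ.LFunction (1 / 2 + I * t) * Complex.exp (-I * x * t) =
      2 * ε * Complex.exp (3 * (π * η * I / 4 + x) / 2) / (q : ℂ) ^ (3 / 4 : ℂ) *
        ∑' n : ℕ, χ n * n *
          Complex.exp (-(π * n ^ 2 * Complex.exp (2 * (π * η * I / 4 + x)) / q)) := by
  have h := platt2016_lemma71_72 hq hχ ε hη x
  rw [charParity_of_odd hχo] at h
  have e0 : (1 / 2 : ℂ) + 1 = 3 / 2 := by norm_num
  simp only [Nat.cast_one, pow_one, e0] at h
  rw [h]
  have e1 : (3 / 2 : ℂ) * (π * η * I / 4 + x) = 3 * (π * η * I / 4 + x) / 2 := by ring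
  have e2 : (q : ℂ) ^ (-(3 / 2 / 2) : ℂ) = 1 / (q : ℂ) ^ (3 / 4 : ℂ) := by
    rw [Complex.cpow_neg, one_div]; norm_num
  rw [e1, e2]
  ring

end Literature.NumberTheory.LFunctions

end
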